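import Summits.NavierStokesRegularity.NavierStokesRegularity.Theorems.ScenarioCensusRowF1WhirlTopKill
import HarnessLib

/-!
# LINE 42 «whirl-top» port, part 3/4: §5 THE FLOORS, proved (`whirlFloor_holds`, `precessionFloor_holds`; LINE 40's `le_of_units` / `row_of_floor` BY NAME), the census ROWS as
# corollaries (`rowF1gx_holds`, `rowF1wx_holds`, `rowF1qx_holds`, `rowF1px_holds`), the threshold `whirlLevel` and the floor read pointwise

Re-homed for the scenario census (typer seat ns-census-typer-1 g10; the cells F1gx / F1wx / F1qx / F1px and the floors WF / PF are members of row F1 «DECIDED IN KERNEL IN FILES» (LINE 42: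
ref ns-census-ref g15 PRE-CHECK ✓ §20.19, critic idea-crit-3 g10 PASS no price tier B 14:05:49Z, lead booking CANDIDATE 3/4 at v1.124 → of record with the critic's PASS); this port
makes them TREE-decided): VERBATIM PORT of ns-idea-3 LINE 42 «whirl-top», `pub/ideators/ns-idea-3/lines/whirl-top/line-whirl-top.lean` sha16 b777a0715a2eb784 (1320 l., lean check rc 0,
0 sorry), split for the 400-line rule into `ScenarioCensusRowF1WhirlTop` (§1–§4a) → `…WhirlTopKill` (§4b) → `…WhirlTopFloors` (§5) → `…WhirlTopRows` (§6–§7 + census KEYS).  Lean text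
VERBATIM in namespace `…Theorems.ScenarioCensus.WhirlTop` (the line's `…Cruxes.ScenarioCensusRowF1.WhirlTopLine` re-homed); port edits: the frame restated VERBATIM by the line from LINES
34–41 (`topSet`, `HasTypeIConstant`, `snapLevel`, `exists_fast_at`, `sqrt_mul_sq_mul`, `limitClass_compact`, `exists_level_of_limitKill`, `exists_witnessZoom_package`, `zoom_units`,
`eventually_forall_not_of_not_frequently`, `continuous_slice'`, `tendsto_eval`, `le_of_units`, `row_of_floor`, `rotLin`, `rotCLM`, `coe_rotCLM`, `analyticAt_rotZ`, `analyticAt_transport`, `rotZ_smul_eZ'`, `stream_fast`)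
is taken BY NAME from the landed two-time-top / one-level-top / snapshot-top / needle-top / echo-top / scaling-top / screw-top ports; elementary lemmas the line restates are the tree's BY
NAME (`rotZ_add_vec'` = `ScrewBlowdown.rotZ_add_vec`, `rotZ_add_smul_eZ'` = `ScrewBlowdown.rotZ_add_smul_eZ`, `rotZ_smul_vec'` = `rotZ_smul`, `rotZ_neg_rotZ'` = `rotZ_neg_apply_rotZ`,
`continuous_rotZ`, `continuous_rotZ_angle'` = `continuous_rotZ_angle`, `centre_mem` = `IsTypeIAncientMild.comp_add_right` (Literature.Analysis.FluidPDE), `rotZ_two_pi'` =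
`RotationOrder.rotZ_two_pi` (census rotation-order port), `addSubgroup_eq_univ_of_irrational_angle` / `forall_of_irrational_angle` = `SymmetricScarExists.RdssSplit.NearIdentity.…` — the
line's own header names the latter two as clones); `analyticAt_linIso` and `tendstoLocallyUniformly_comp_of_tendsto` (twins of lemmas in route-cone modules that are not imported) are not
re-declared — the former's one-line proof term is inlined; `@[conjecture]` on the residual `WhirlCollapse` (≡ `ScenarioCensus.Row_F1`, OPEN); one-line docstrings added where missing (gate
lint).  Statements untouched.

No census VALUE is moved here (row F1 stays OPEN-WITH-LINE; the members become TREE-decided by name); NS regularity is NOT proved; `Row_F1` is untouched (zero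
movement, `whirlCollapse_iff_rowF1`); no summit statement is proved by this file. Lemmas that restate already-landed tree declarations are taken BY NAME (gate lint `dedup.landed`): `topSet` = `TwoTimeTop.topSet`, `HasTypeIConstant` = `OneLevelTop.HasTypeIConstant`, `snapLevel` = `SnapshotTop.snapLevel`, `exists_fast_at` = `SnapshotTop.exists_fast_at`, `sqrt_mul_sq_mul` = `SnapshotTop.sqrt_mul_sq_mul`, `limitClass_compact` = `NeedleTop.limitClass_compact`, `exists_level_of_limitKill` = `NeedleTop.exists_level_of_limitKill`, `zoom_units` = `NeedleTop.zoom_units`, `exists_witnessZoom_package` = `EchoTop.exists_witnessZoom_package`, `eventually_forall_not_of_not_frequently` = `EchoTop.eventually_forall_not_of_not_frequently`, `centre_mem` = `IsTypeIAncientMild.comp_add_right`, `continuous_slice'` = `ScalingTop.continuous_slice'`, `tendsto_eval` = `ScalingTop.tendsto_eval`, `le_of_units` = `ScalingTop.le_of_units`, `rotZ_add_vec'` = `ScrewBlowdown.rotZ_add_vec`, `rotZ_smul_vec'` = `rotZ_smul`, `rotZ_add_smul_eZ'` = `ScrewBlowdown.rotZ_add_smul_eZ`, `rotLin` = `ScrewTop.rotLin`,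 `rotCLM` = `ScrewTop.rotCLM`, `analyticAt_rotZ` = `ScrewTop.analyticAt_rotZ`, `rotZ_neg_rotZ'` = `rotZ_neg_apply_rotZ`, `rotZ_two_pi'` = `RotationOrder.rotZ_two_pi`, `continuous_rotZ_angle'` = `continuous_rotZ_angle`, `addSubgroup_eq_univ_of_irrational_angle` = `SymmetricScarExists.RdssSplit.NearIdentity.addSubgroup_eq_top_of_irrational_angle`, `forall_of_irrational_angle` = `SymmetricScarExists.RdssSplit.NearIdentity.forall_of_irrational_angle_stabiliser`, `analyticAt_transport` = `ScrewTop.analyticAt_transport`, `rotZ_smul_eZ'` = `ScrewTop.rotZ_smul_eZ'`, `row_of_floor` = `ScalingTop.row_of_floor`, `stream_fast` = `ScrewTop.stream_fast`.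
-/

-- the summit and its single problem share the name `NavierStokesRegularity` (D-0017 nested layout)
set_option linter.dupNamespace false

noncomputable section

open MeasureTheory Set Function Filter TopologicalSpace Metric
open scoped Topology NNReal ENNReal InnerProductSpace

namespace Summit.NavierStokesRegularity.NavierStokesRegularity.Theorems.ScenarioCensus.WhirlTop

open Literature.Analysis Literature.Analysis.FluidPDE
open Summit.NavierStokesRegularity.NavierStokesRegularity.Theorems
open Summit.NavierStokesRegularity.NavierStokesRegularity.Theses
open Summit.NavierStokesRegularity.NavierStokesRegularity.Theorems.LocalHelicityTubeDoorFrobeniusProfileRigidityHelicalSlice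
open Summit.NavierStokesRegularity.NavierStokesRegularity.Theorems.NearExtremalTransiencePerFlow.FilamentSelection
open Summit.NavierStokesRegularity.NavierStokesRegularity.Theorems.LocalSineTubeDoorProfileAlignedWindowRigidityAncient

/-! ## §5 THE FLOORS (universal over fast points, every level), proved; the census ROWS as corollaries (Leray's every-time floor);
the definite whirl threshold and the floor read out at it -/

-- `zoom_units`: the line restates the tree's `NeedleTop.zoom_units`; taken BY NAME (gate lint dedup.landed).

-- `eventually_forall_not_of_not_frequently`: the line restates the tree's `EchoTop.eventually_forall_not_of_not_frequently`; taken BY NAME (gate lint dedup.landed).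

-- `le_of_units`: the line restates the tree's `ScalingTop.le_of_units`; taken BY NAME (gate lint dedup.landed).

/-- **THE WHIRL FLOOR holds** (witness package of §3 + whirl level of §4; the pocket read in the zoom is a whirl defect of the zoom with
the SAME dimensionless apex `b_j` — `L⁻¹` and `R_θ` are linear, so the speed unit factors out —, and the whirl limit carries it to the
limit). -/
theorem whirlFloor_holds : WhirlFloor := by
  intro M Λ L Θ A a hΛ hΘ ha
  obtain ⟨Λ₁, hΛ₁, hlev⟩ := exists_whirlLevel M L A a hΘ ha hΛ
  refine ⟨Λ₁, hΛ₁, ?_⟩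
  intro ν T hν hT u p hsol hLH hdec hM
  refine EchoTop.eventually_forall_not_of_not_frequently fun hfreq => ?_
  obtain ⟨c, x, W, hcpos, -, hW, hQ, -, -, -, hlu, hnorm⟩ :=
    EchoTop.exists_witnessZoom_package hν hT hsol hLH hdec hM hfreq
  apply hlev W hW hnorm
  set F : ℕ → ℝ → E3 → E3 := fun j s y => (c j * 1) • u (T + c j ^ 2 * ν * s) (x j + (c j * ν) • y) with hF
  have hpk : ∀ j, ∃ b ∈ closedBall (0 : E3) A, ∀ θ ∈ Θ, ∀ w ∈ closedBall (0 : E3) a,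
      ‖L.symm (F j (-1) (b + L (rotZ θ w))) - rotZ θ (L.symm (F j (-1) (b + L w)))‖ ≤ Λ₁ := by
    intro j
    obtain ⟨hunit, hsq⟩ := NeedleTop.zoom_units (T := T) hν hcpos j
    obtain ⟨b, hb, hpock⟩ := hQ j
    refine ⟨b, mem_closedBall_zero_iff.2 hb, fun θ hθ w hw => ?_⟩
    have h1 := hpock θ hθ w (mem_closedBall_zero_iff.1 hw)
    rw [hsq, hunit] at h1
    simp only [hF]
    rw [LinearIsometryEquiv.map_smul, LinearIsometryEquiv.map_smul, rotZ_smul, ← smul_sub, norm_smul, Real.norm_eq_abs,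
      abs_of_pos (mul_pos (hcpos j) one_pos), mul_one]
    exact ScalingTop.le_of_units hν h1
  exact whirl_limit (fun s hs => ScalingTop.continuous_slice' hW hs) (fun s hs => hlu s hs) tendsto_const_nhds hpk

/-- **THE PRECESSION FLOOR holds** (witness package + precession level; the lagged instant `t_j − θ(T − t_j)` is the slice `−1 − θ` of
the `j`-th zoom, EXACTLY). -/
theorem precessionFloor_holds : PrecessionFloor := by
  intro M Λ L d θ A a hΛ hθ ha
  obtain ⟨Λ₁, hΛ₁, hlev⟩ := exists_precessionLevel M L d A a hθ ha hΛ
  refine ⟨Λ₁, hΛ₁, ?_⟩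
  intro ν T hν hT u p hsol hLH hdec hM
  refine EchoTop.eventually_forall_not_of_not_frequently fun hfreq => ?_
  obtain ⟨c, x, W, hcpos, -, hW, hQ, -, -, -, hlu, hnorm⟩ :=
    EchoTop.exists_witnessZoom_package hν hT hsol hLH hdec hM hfreq
  apply hlev W hW hnorm
  set F : ℕ → ℝ → E3 → E3 := fun j s y => (c j * 1) • u (T + c j ^ 2 * ν * s) (x j + (c j * ν) • y) with hF
  have hpk : ∀ j, ∃ b ∈ closedBall (0 : E3) A, ∀ w ∈ closedBall (0 : E3) a,
      ‖F j (-1) (b + (L w + d)) - L (F j (-1 - θ) (b + w))‖ ≤ Λ₁ := by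
    intro j
    obtain ⟨hunit, hsq⟩ := NeedleTop.zoom_units (T := T) hν hcpos j
    obtain ⟨b, hb, hpock⟩ := hQ j
    refine ⟨b, mem_closedBall_zero_iff.2 hb, fun w hw => ?_⟩
    have h1 := hpock w (mem_closedBall_zero_iff.1 hw)
    have hlag : T + c j ^ 2 * ν * (-1) - θ * (T - (T + c j ^ 2 * ν * (-1))) = T + c j ^ 2 * ν * (-1 - θ) := by ring
    rw [hsq, hunit, hlag] at h1
    simp only [hF]
    rw [LinearIsometryEquiv.map_smul, ← smul_sub, norm_smul, Real.norm_eq_abs, abs_of_pos (mul_pos (hcpos j) one_pos), mul_one]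
    exact ScalingTop.le_of_units hν h1
  exact precession_limit hθ (fun s hs => ScalingTop.continuous_slice' hW hs) (fun s hs => hlu s hs) tendsto_const_nhds hpk

-- `row_of_floor`: the line restates the tree's `ScalingTop.row_of_floor`; taken BY NAME (gate lint dedup.landed).

/-- **ROW F1gx holds** (whirl floor at `c_S` + Leray's every-time floor). -/
theorem rowF1gx_holds : Row_F1gx := by
  intro M L Θ A a hΘ ha
  obtain ⟨ε, hε, hfl⟩ := whirlFloor_holds M SnapshotTop.snapLevel L Θ A a SnapshotTop.snapLevel_pos hΘ ha
  exact ⟨ε, hε, fun ν T hν hT u p hsol hLH hdec hM hfreq =>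
    ScalingTop.row_of_floor hν hT hsol hLH hdec (hfl ν T hν hT u p hsol hLH hdec hM) hfreq⟩

/-- **ROW F1wx holds** (LINE 41's declined pitch-`0` cell: an interval generates, `generatesAngles_Icc`). -/
theorem rowF1wx_holds : Row_F1wx := fun M L θ₁ θ₂ A a h12 ha =>
  rowF1gx_holds M L (Icc θ₁ θ₂) A a (generatesAngles_Icc h12) ha

/-- **ROW F1qx holds** (one irrational turn generates, `generatesAngles_singleton`). -/
theorem rowF1qx_holds : Row_F1qx := fun M L θ₀ A a hirr ha =>
  rowF1gx_holds M L {θ₀} A a (generatesAngles_singleton hirr) ha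

/-- **ROW F1px holds** (precession floor at `c_S`). -/
theorem rowF1px_holds : Row_F1px := by
  intro M L d θ A a hθ ha
  obtain ⟨ε, hε, hfl⟩ := precessionFloor_holds M SnapshotTop.snapLevel L d θ A a SnapshotTop.snapLevel_pos hθ ha
  exact ⟨ε, hε, fun ν T hν hT u p hsol hLH hdec hM hfreq =>
    ScalingTop.row_of_floor hν hT hsol hLH hdec (hfl ν T hν hT u p hsol hLH hdec hM) hfreq⟩

open scoped Classical in
/-- **The definite whirl threshold `whirlLevel M Λ L Θ A a`** — a witness of the floor (ineffective: compactness); `1` off the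
admissible parameter range (classical `if` on the admissibility predicate). -/
def whirlLevel (M Λ : ℝ) (L : E3 ≃ₗᵢ[ℝ] E3) (Θ : Set ℝ) (A a : ℝ) : ℝ :=
  if hp : 0 < Λ ∧ GeneratesAngles Θ ∧ 0 < a then
    Classical.choose (whirlFloor_holds M Λ L Θ A a hp.1 hp.2.1 hp.2.2) else 1

/-- The definite whirl-pocket threshold is positive. -/
theorem whirlLevel_pos (M Λ : ℝ) (L : E3 ≃ₗᵢ[ℝ] E3) (Θ : Set ℝ) (A a : ℝ) : 0 < whirlLevel M Λ L Θ A a := by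
  unfold whirlLevel
  split_ifs with hp
  · exact (Classical.choose_spec (whirlFloor_holds M Λ L Θ A a hp.1 hp.2.1 hp.2.2)).1
  · exact one_pos

/-- **THE WHIRL FLOOR, read out at its definite threshold**: in a Clay solution with Type-I constant `M`, for all late instants `t`, EVERY
`Λ`-fast point `x` and EVERY candidate apex `x + ℓb`, `‖b‖ ≤ A`, admit an angle `θ ∈ Θ` and a point `w`, `‖w‖ ≤ a`, at which the
snapshot FAILS to be rotationally equivariant: `√(T − t)‖L⁻¹u(t, x_* + ℓL(R_θ w)) − R_θ L⁻¹u(t, x_* + ℓLw)‖ > whirlLevel · √ν`. -/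
theorem whirlFloor_read {M Λ : ℝ} {L : E3 ≃ₗᵢ[ℝ] E3} {Θ : Set ℝ} {A a : ℝ} (hΛ : 0 < Λ) (hΘ : GeneratesAngles Θ) (ha : 0 < a)
    {ν T : ℝ} (hν : 0 < ν) (hT : 0 < T) {u : ℝ → E3 → E3} {p : ℝ → E3 → ℝ}
    (hsol : IsClassicalNSSolutionOn (Ico 0 T) ν 0 u p) (hLH : IsLerayHopfOn T ν 0 (u 0) u)
    (hdec : HasRapidSpatialDecay (u 0)) (hM : OneLevelTop.HasTypeIConstant ν T M u) :
    ∀ᶠ t in 𝓝[<] T, ∀ x ∈ TwoTimeTop.topSet ν T u Λ t, ∀ b : E3, ‖b‖ ≤ A →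
      ∃ θ ∈ Θ, ∃ w : E3, ‖w‖ ≤ a ∧
        whirlLevel M Λ L Θ A a * Real.sqrt ν <
          Real.sqrt (T - t) * ‖L.symm (u t (x + (Real.sqrt (ν * (T - t))) • (b + L (rotZ θ w))))
            - rotZ θ (L.symm (u t (x + (Real.sqrt (ν * (T - t))) • (b + L w))))‖ := by
  have hp : 0 < Λ ∧ GeneratesAngles Θ ∧ 0 < a := ⟨hΛ, hΘ, ha⟩
  have hspec := (Classical.choose_spec (whirlFloor_holds M Λ L Θ A a hp.1 hp.2.1 hp.2.2)).2
    ν T hν hT u p hsol hLH hdec hM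
  have hlev : whirlLevel M Λ L Θ A a = Classical.choose (whirlFloor_holds M Λ L Θ A a hp.1 hp.2.1 hp.2.2) := by
    unfold whirlLevel
    rw [dif_pos hp]
  filter_upwards [hspec] with t ht x hx b hb
  by_contra hno
  push Not at hno
  exact ht x hx ⟨b, hb, fun θ hθ w hw => by have h' := hno θ hθ w hw; rwa [hlev] at h'⟩

end Summit.NavierStokesRegularity.NavierStokesRegularity.Theorems.ScenarioCensus.WhirlTop

end
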